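import Literature.AlgebraicGeometry.HodgeTheory.ComplexOrientationFamily
import Literature.AlgebraicGeometry.HodgeTheory.HolomorphicBundleChernCharacterProjectiveSpace
import Literature.AlgebraicGeometry.Motives.ComplexPointsEhresmann
import Literature.AlgebraicTopology.SingularHomology.LocalHomologyVanishing
import Literature.NumberTheory.Transcendental.AnalytificationProper
import Literature.NumberTheory.Transcendental.AnalytificationProjProofs
import HarnessLib

/-!
# Homology of a smooth projective variety punctured at a point: `Hₖ((X ∖ x)(ℂ)) ≅ Hₖ(X(ℂ))` below
# the top two degrees

Family `hodge`, layer `Literature/AlgebraicGeometry/HodgeTheory`. A. Hatcher, *Algebraic Topology*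
(2002), §3.3 p. 231 (`Hₖ(M | x) = 0` for `k ≠ n` on an `n`-manifold) with the long exact sequence of
the pair `(M, M ∖ {x})` (Thm. 2.13 ff.): removing a point from a topological `n`-manifold does not
change `Hₖ` for `k ≤ n - 2`. Read on the complex points `X(ℂ)` of a smooth projective complex variety
of dimension `n` — a closed topological `2n`-manifold (`Motives.IsSmoothProjective.chartedSpace`) — and
on the complex points `U(ℂ)` of the open subscheme `U = X ∖ {x}` of a closed point `x` (an open
embedding onto `X(ℂ) ∖ {x}`, SGA1 XII Prop. 3.1 (xi), the tree's theorems
`AlgPoints.isOpenEmbedding_map_holds`, `AlgPoints.range_map_of_isOpenImmersion_holds`):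

* `bijective_map_subsetIncl_compl_singleton` — **`Hₖ(X(ℂ) ∖ {P₀}; ℂ) → Hₖ(X(ℂ); ℂ)` is bijective for
  `k + 2 ≤ 2 dim X`**;
* `range_map_openSubschemeOverι_eq_compl_singleton`, `bijective_map_openSubschemeOverι_compl_point` —
  **`Hₖ(U(ℂ); ℂ) → Hₖ(X(ℂ); ℂ)` is bijective for `U = X ∖ {x}`, `x` a closed point, `k + 2 ≤ 2 dim X`**,
  and `finrank_singularHomology_openSubschemeOver_compl_point`;
* `finrank_singularHomology_projectiveSpace_eq_one`, `finrank_singularHomology_puncturedProjectiveSpace_eq_one`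
  — **`H_{2p}(ℙᴺ(ℂ); ℂ)` and `H_{2p}((ℙᴺ ∖ x)(ℂ); ℂ)` are lines** (`p ≤ N`, resp. `p + 1 ≤ N`):
  Poincaré duality with `dim H^{2(N-p)}(ℙᴺ(ℂ); ℂ) = 1` (Hatcher Thm. 3.19, the tree's
  `finrank_complexBetti_projectiveSpace_two_mul_eq_one`).

These feed the degree computation of hypersurface classes in projective space through the linear
projection from a point (sequel). Everything is proved; no definitions, no named facts.

## References

* [HatcherAT2002] A. Hatcher, Algebraic Topology, CUP 2002, §2.1 Thm. 2.13 ff., §3.3 p. 231,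
  Thm. 3.19, Thm. 3.30.
* [SGA1] A. Grothendieck, M. Raynaud, SGA 1, Exp. XII Thm. 1.1 and Prop. 3.1 (xi).
-/

noncomputable section

open CategoryTheory CategoryTheory.Limits AlgebraicGeometry
open Literature.AlgebraicTopology.SingularHomology

namespace Literature.AlgebraicGeometry.HodgeTheory

section HodgeTheory

open Literature.AlgebraicGeometry.Motives

variable {n : ℕ} {X : Motives.SchemeOver ℂ}

/-! ### Puncturing the manifold `X(ℂ)` at a complex point -/

/-- **Removing a point does not change `Hₖ` for `k + 2 ≤ 2 dim X`**: for `X` smooth projective of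
dimension `n` and a complex point `P₀`, the map `Hₖ(X(ℂ) ∖ {P₀}; ℂ) → Hₖ(X(ℂ); ℂ)` induced by the
inclusion is bijective whenever `k + 2 ≤ 2n` — from the long exact sequence of the pair
`(X(ℂ), X(ℂ) ∖ {P₀})` and `H_j(X(ℂ) | P₀) = 0` for `j ≠ 2n` (`X(ℂ)` is a `2n`-manifold).
[cite: HatcherAT2002, §2.1 Thm. 2.13 ff. and §3.3 p. 231] -/
theorem bijective_map_subsetIncl_compl_singleton (hX : IsSmoothProjective n X)
    (P₀ : ComplexPoints X) {k : ℕ} (hk : k + 2 ≤ 2 * n) :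
    Function.Bijective (singularHomology.map ℂ ℂ
      (subsetIncl ({P₀}ᶜ : Set (ComplexPoints X))) k) := by
  letI := hX.chartedSpace
  haveI := ComplexPoints.t2Space_of_isSmoothProjective hX
  have hzero : ∀ {j : ℕ}, j ≠ 2 * n →
      IsZero (relativeSingularHomology ℂ ℂ (ComplexPoints X) ({P₀}ᶜ : Set (ComplexPoints X)) j) :=
    fun hj ↦ isZero_localHomology_holds ℂ ℂ (ComplexPoints X) P₀ hj
  constructor
  · -- `H_{k+1}(X | P₀) = 0 ⟶ Hₖ(X ∖ P₀) ⟶ Hₖ(X)` exact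
    have hex := relativeSingularHomology.exact_δ_map ℂ ℂ (X := ComplexPoints X) ({P₀}ᶜ) k
    have hmono := hex.mono_g ((hzero (j := k + 1) (by omega)).eq_of_src _ _)
    exact (ModuleCat.mono_iff_injective _).1 hmono
  · -- `Hₖ(X ∖ P₀) ⟶ Hₖ(X) ⟶ Hₖ(X | P₀) = 0` exact
    have hex := relativeSingularHomology.exact_map_ofAbsolute ℂ ℂ (X := ComplexPoints X) ({P₀}ᶜ) k
    have hepi := hex.epi_f ((hzero (j := k) (by omega)).eq_of_tgt _ _)
    exact (ModuleCat.epi_iff_surjective _).1 hepi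

/-! ### The open subscheme `X ∖ {x}` of a closed point -/

/-- For the open subscheme `U = X ∖ {x}` of a closed point (`U(ℂ) ↪ X(ℂ)` an open embedding), the
range of `U(ℂ) → X(ℂ)` is the complement of the complex point `P₀` over `x`.
[cite: SGA1, Exp. XII Thm. 1.1, proof a)] -/
theorem range_map_openSubschemeOverι_eq_compl_singleton [LocallyOfFiniteType X.hom]
    {x : X.left} (O : X.left.Opens) (hO : (O : Set X.left) = {x}ᶜ) (P₀ : ComplexPoints X)
    (hP₀ : P₀.pt = x) :
    Set.range (AlgPoints.map (L := ℂ) (openSubschemeOverι X O)) = ({P₀}ᶜ : Set (ComplexPoints X)) := by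
  haveI : IsOpenImmersion (openSubschemeOverι X O).left := inferInstanceAs (IsOpenImmersion O.ι)
  rw [AlgPoints.range_map_of_isOpenImmersion_holds (openSubschemeOverι X O)]
  ext Q
  have hrange : Set.range O.ι.base = {x}ᶜ := by
    rw [Scheme.Opens.range_ι, hO]
  change Q.pt ∈ Set.range O.ι.base ↔ Q ∈ ({P₀}ᶜ : Set _)
  rw [hrange, Set.mem_compl_iff, Set.mem_singleton_iff, Set.mem_compl_iff, Set.mem_singleton_iff]
  constructor
  · intro h hQ
    exact h (by rw [hQ, hP₀])
  · intro h hpt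
    exact h (ComplexPoints.ext_of_pt_eq (hpt.trans hP₀.symm))

/-- **Removing a closed point does not change `Hₖ` for `k + 2 ≤ 2 dim X`, scheme form**: for `X`
smooth projective of dimension `n`, a closed point `x` and the open subscheme `U = X ∖ {x}`
(`Motives.openSubschemeOver`), the map `Hₖ(U(ℂ); ℂ) → Hₖ(X(ℂ); ℂ)` induced by `U ⟶ X` is bijective
for `k + 2 ≤ 2n`: `U(ℂ) ≅ X(ℂ) ∖ {P₀}` over `X(ℂ)` and `bijective_map_subsetIncl_compl_singleton`.
[cite: HatcherAT2002, §2.1 Thm. 2.13 ff. and §3.3 p. 231] [cite: SGA1, Exp. XII Prop. 3.1 (xi)] -/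
theorem bijective_map_openSubschemeOverι_compl_point (hX : IsSmoothProjective n X) {x : X.left}
    (hx : IsClosed ({x} : Set X.left)) (O : X.left.Opens) (hO : (O : Set X.left) = {x}ᶜ) {k : ℕ}
    (hk : k + 2 ≤ 2 * n) :
    Function.Bijective (singularHomology.map ℂ ℂ
      (AlgPoints.mapContinuous (L := ℂ) (openSubschemeOverι X O)) k) := by
  haveI : LocallyOfFiniteType X.hom := by
    haveI := hX.smoothOfRelativeDimension
    haveI : Smooth X.hom := SmoothOfRelativeDimension.smooth n _
    infer_instance
  haveI : IsOpenImmersion (openSubschemeOverι X O).left := inferInstanceAs (IsOpenImmersion O.ι)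
  obtain ⟨P₀, hP₀⟩ := AlgPoints.exists_pt_eq_of_isClosed (L := ℂ) x hx
  have hrange := range_map_openSubschemeOverι_eq_compl_singleton O hO P₀ hP₀
  set j : C(ComplexPoints (openSubschemeOver X O), ComplexPoints X) :=
    AlgPoints.mapContinuous (L := ℂ) (openSubschemeOverι X O) with hjdef
  have hje : Topology.IsOpenEmbedding j := AlgPoints.isOpenEmbedding_map_holds (openSubschemeOverι X O)
  -- `U(ℂ) ≃ₜ X(ℂ) ∖ {P₀}` over `X(ℂ)`
  let e : ComplexPoints (openSubschemeOver X O) ≃ₜ ({P₀}ᶜ : Set (ComplexPoints X)) :=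
    hje.isEmbedding.toHomeomorph.trans (Homeomorph.setCongr hrange)
  have hfac : j = (subsetIncl ({P₀}ᶜ : Set (ComplexPoints X))).comp (e : C(_, _)) := by
    ext u
    rfl
  rw [hfac, singularHomology.map_comp]
  exact (bijective_map_subsetIncl_compl_singleton hX P₀ hk).comp
    (ConcreteCategory.bijective_of_isIso (singularHomology.mapIso ℂ ℂ e k).hom)

/-- **`dim Hₖ((X ∖ x)(ℂ); ℂ) = dim Hₖ(X(ℂ); ℂ)`** for `k + 2 ≤ 2 dim X`.
[cite: HatcherAT2002, §2.1 Thm. 2.13 ff. and §3.3 p. 231] -/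
theorem finrank_singularHomology_openSubschemeOver_compl_point (hX : IsSmoothProjective n X)
    {x : X.left} (hx : IsClosed ({x} : Set X.left)) (O : X.left.Opens) (hO : (O : Set X.left) = {x}ᶜ)
    {k : ℕ} (hk : k + 2 ≤ 2 * n) :
    Module.finrank ℂ (singularHomology ℂ ℂ (ComplexPoints (openSubschemeOver X O)) k) =
      Module.finrank ℂ (singularHomology ℂ ℂ (ComplexPoints X) k) :=
  (LinearEquiv.ofBijective (singularHomology.map ℂ ℂ
    (AlgPoints.mapContinuous (L := ℂ) (openSubschemeOverι X O)) k).hom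
    (bijective_map_openSubschemeOverι_compl_point hX hx O hO hk)).finrank_eq

/-! ### Projective space -/

/-- **`H_{2p}(ℙᴺ(ℂ); ℂ)` is a line** for `p ≤ N` (Poincaré duality for the complex orientation of the
closed `2N`-manifold `ℙᴺ(ℂ)` and `dim H^{2(N-p)}(ℙᴺ(ℂ); ℂ) = 1`). [cite: HatcherAT2002, Thm. 3.19 and Thm. 3.30] -/
theorem finrank_singularHomology_projectiveSpace_eq_one (N : ℕ) {p : ℕ} (hp : p ≤ N) :
    Module.finrank ℂ (singularHomology ℂ ℂ (ComplexPoints (projectiveSpace N ℂ)) (2 * p)) = 1 := by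
  have hP : IsSmoothProjective N (projectiveSpace N ℂ) := isSmoothProjective_projectiveSpace' N
  have hPD := hasPoincareDuality_complexOrientationFamily hP (show 2 * (N - p) + 2 * p = 2 * N by omega)
  rw [← (LinearEquiv.ofBijective _ hPD).finrank_eq]
  exact finrank_complexBetti_projectiveSpace_two_mul_eq_one N (p := N - p) (by omega)

/-- **`H_{2p}((ℙᴺ ∖ x)(ℂ); ℂ)` is a line** for `x` a closed point and `p + 1 ≤ N` (the punctured
projective space has the same `H_{2p}` as `ℙᴺ(ℂ)` in these degrees). [cite: HatcherAT2002, §3.3 p. 231 and Thm. 3.19] -/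
theorem finrank_singularHomology_puncturedProjectiveSpace_eq_one (N : ℕ) {x : (projectiveSpace N ℂ).left}
    (hx : IsClosed ({x} : Set (projectiveSpace N ℂ).left)) (O : (projectiveSpace N ℂ).left.Opens)
    (hO : (O : Set (projectiveSpace N ℂ).left) = {x}ᶜ) {p : ℕ} (hp : p + 1 ≤ N) :
    Module.finrank ℂ (singularHomology ℂ ℂ (ComplexPoints (openSubschemeOver (projectiveSpace N ℂ) O))
      (2 * p)) = 1 := by
  have hP : IsSmoothProjective N (projectiveSpace N ℂ) := isSmoothProjective_projectiveSpace' N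
  rw [finrank_singularHomology_openSubschemeOver_compl_point hP hx O hO (k := 2 * p) (by omega)]
  exact finrank_singularHomology_projectiveSpace_eq_one N (by omega)

end HodgeTheory

end Literature.AlgebraicGeometry.HodgeTheory

end
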